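import Summits.Ventures.Crystal3D.Theorems.StickyWulffConstantGenericWallFloorBarlowOrientedGlueApart
import Summits.Ventures.Crystal3D.Theorems.StickyWulffConstantGenericWallFloorBarlowCoverableGlue
import HarnessLib

/-!
# Lane T's zig `hlines` for Δ-steep pairs under FRAME SEPARATION of the zig corners, any orientation (option (C)):
# `barlow_hlines_zigApart` — the `FramesApart` replacement of `barlow_hlines_coverable`
# (crux `GenericWallFloor`, stmt-Ventures-19480, line `WallLedgerG`; v6.13 parts v4: `WalkerCovered′ := ΔSteep₁ ∧ ΔSteep₂ ∧ FluxDominated ∧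
# FramesApart`, cf-p1 19:29:34Z / 19:39:56Z «barlow_hlines_apart»)

HONEST FRAMING. Venture `Summits/Ventures/Crystal3D` (cell `crystal3d-full`), helper `--supports` the crux `GenericWallFloor`
(stmt-Ventures-19480) of `route-Ventures-StickyWulffConstant`, registered line `WallLedgerG`, open stub `stub_twoSlabAdhesion`.
Rung credit only; F-C1 not moved; NOT the stub.  Inputs BY NAME: E1 (`hsE`, `hcert`), `DoubleStarCoaxialAt` / `CapPairCoaxial`
(`hDS`, `hCP`, from `StarPairFar`).

Verbatim `barlow_hlines_coverable` (`…BarlowCoverableGlue`: both plates Δ-steep, up-presented by `exists_upPresentation`, selectors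
transported back) with `hoff : BarlowOffReach …` (three REACH-SET clauses) replaced by three FRAME clauses `hA1 hA2 hA3` for the zig corner
frame sets `chainFrames (±e₃) (upFrame Lᵢ zᵢ) (famSlot Lᵢ zᵢ)`: no frame carries the other plate's bilayer lattice `L·Λ₀` or its basal twin
`(twinFrame L (L e₃))·Λ₀`, and no two frames of the two families are Barlow-coaxial — for `ZigGood` plates these are EXACTLY clauses (i),
(ii), (iii) of `FramesApart` (`corner_of_zigGood`).  The count is `barlow_hlines_oriented_apart` (`…BarlowOrientedGlueApart`; core
avoidance `…BarlowCoreAvoid` + frame-separated ledger `…WalkerFamilyLedgerSep` underneath).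
* `apart_upFrame` — the two presentations of a plate have the same lattice pair `{L·Λ₀, (twinFrame L (L e₃))·Λ₀}`.
* **`barlow_hlines_zigApart`** — conclusion verbatim that of `barlow_hlines_coverable` (`#T₁ + #T₂ + 18 m ρ ≤ Σ_PAY(12−deg) +
  (318 + 192 R₀)(1+h)ρ`).
WHAT THIS IS NOT: the ROW-covered stub closer is `…BarlowRowCovGlueApart`; whether v6.13's `WalkerCovered′` keys on `FramesApart` with
`ZigGood` or on these zig clauses directly is lane T's typing choice; F-C1 not moved.
-/

noncomputable section

namespace Summit.Ventures.Crystal3D.Theorems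

open Finset
open Literature.MathematicalPhysics.StatisticalMechanics (barlowPos barlowStacking basalMirror haggLabel barlowOffset IsHaggSeq
  triangularVec₁ triangularVec₂ fccStacking)
open Summit.Ventures.Crystal3D.Cruxes.TextureLiminf.TexShadow (stacking cyl upSlot₁ upSlot₂ upSlot₃ bilayerRise upFrame upWord famSlot
  DeltaSteep stacking_upFrame upFrame_axis_nonneg isHaggSeq_upWord famSlot_steep_of_deltaSteep)
open scoped InnerProductSpace

/-- **The two presentations of a plate have the same lattice pair**: `A ≠ L·Λ₀ ∧ A ≠ (twinFrame L (L e₃))·Λ₀` implies the same for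
the up-presentation frame `upFrame L z` (which is `L` or `L ∘ basalMirror`, whose twin across its own axis is `L` again). -/
theorem apart_upFrame (L : EuclideanSpace ℝ (Fin 3) ≃ₗᵢ[ℝ] EuclideanSpace ℝ (Fin 3)) (z : EuclideanSpace ℝ (Fin 3))
    {A : Set (EuclideanSpace ℝ (Fin 3))}
    (h : A ≠ L '' fccStacking 1 (Real.sqrt (2 / 3)) ∧
      A ≠ (twinFrame L (L (EuclideanSpace.single (2 : Fin 3) (1 : ℝ)))) '' fccStacking 1 (Real.sqrt (2 / 3))) :
    A ≠ (upFrame L z) '' fccStacking 1 (Real.sqrt (2 / 3)) ∧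
      A ≠ (twinFrame (upFrame L z) ((upFrame L z) (EuclideanSpace.single (2 : Fin 3) (1 : ℝ)))) '' fccStacking 1 (Real.sqrt (2 / 3)) := by
  have hMM : ∀ x : EuclideanSpace ℝ (Fin 3), basalMirror (basalMirror x) = x := fun x => Submodule.reflection_reflection _ _
  unfold upFrame
  split_ifs with hz
  · exact h
  · set L' : EuclideanSpace ℝ (Fin 3) ≃ₗᵢ[ℝ] EuclideanSpace ℝ (Fin 3) := basalMirror.trans L with hL'
    have e1 : L' '' fccStacking 1 (Real.sqrt (2 / 3)) =
        (twinFrame L (L (EuclideanSpace.single (2 : Fin 3) (1 : ℝ)))) '' fccStacking 1 (Real.sqrt (2 / 3)) := by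
      have : (L' : EuclideanSpace ℝ (Fin 3) → EuclideanSpace ℝ (Fin 3)) =
          (twinFrame L (L (EuclideanSpace.single (2 : Fin 3) (1 : ℝ))) : EuclideanSpace ℝ (Fin 3) → EuclideanSpace ℝ (Fin 3)) := by
        funext x; rw [hL', LinearIsometryEquiv.trans_apply, twinFrame_axis_apply]
      rw [this]
    have e2 : (twinFrame L' (L' (EuclideanSpace.single (2 : Fin 3) (1 : ℝ)))) '' fccStacking 1 (Real.sqrt (2 / 3)) =
        L '' fccStacking 1 (Real.sqrt (2 / 3)) := by
      have : ((twinFrame L' (L' (EuclideanSpace.single (2 : Fin 3) (1 : ℝ)))) : EuclideanSpace ℝ (Fin 3) → EuclideanSpace ℝ (Fin 3)) =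
          (L : EuclideanSpace ℝ (Fin 3) → EuclideanSpace ℝ (Fin 3)) := by
        funext x; rw [twinFrame_axis_apply, hL', LinearIsometryEquiv.trans_apply, hMM]
      rw [this]
    rw [e1, e2]
    exact ⟨h.2, h.1⟩

/-- **Lane T's zig `hlines` for Δ-steep pairs whose ZIG corner frames are apart, any orientation.**  See the module docstring. -/
theorem barlow_hlines_zigApart
    {sE : EuclideanSpace ℝ (Fin 3)} (hsE : sE ∈ fccSlots) (hcert : ExactOnly 0 (fccSlots.filter fun w => 0 < ⟪w, sE⟫_ℝ))
    (hDS : ∀ F₁ F₂ : EuclideanSpace ℝ (Fin 3) ≃ₗᵢ[ℝ] EuclideanSpace ℝ (Fin 3), DoubleStarCoaxialAt F₁ F₂) (hCP : CapPairCoaxial)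
    (R₀ : ℝ) (hR₀ : 6 ≤ R₀) {σ₁ σ₂ : ℤ → ℤ} (hσ₁ : IsHaggSeq σ₁) (hσ₂ : IsHaggSeq σ₂)
    (L₁ L₂ : EuclideanSpace ℝ (Fin 3) ≃ₗᵢ[ℝ] EuclideanSpace ℝ (Fin 3)) (s₁ s₂ : EuclideanSpace ℝ (Fin 3))
    (hA1 : ∀ F ∈ chainFrames (EuclideanSpace.single (2 : Fin 3) (1 : ℝ)) (upFrame L₁ (EuclideanSpace.single (2 : Fin 3) (1 : ℝ))) (famSlot L₁ (EuclideanSpace.single (2 : Fin 3) (1 : ℝ))),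
      F '' fccStacking 1 (Real.sqrt (2 / 3)) ≠ L₂ '' fccStacking 1 (Real.sqrt (2 / 3)) ∧
      F '' fccStacking 1 (Real.sqrt (2 / 3)) ≠ (twinFrame L₂ (L₂ (EuclideanSpace.single (2 : Fin 3) (1 : ℝ)))) '' fccStacking 1 (Real.sqrt (2 / 3)))
    (hA2 : ∀ F ∈ chainFrames (-EuclideanSpace.single (2 : Fin 3) (1 : ℝ)) (upFrame L₂ (-EuclideanSpace.single (2 : Fin 3) (1 : ℝ))) (famSlot L₂ (-EuclideanSpace.single (2 : Fin 3) (1 : ℝ))),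
      F '' fccStacking 1 (Real.sqrt (2 / 3)) ≠ L₁ '' fccStacking 1 (Real.sqrt (2 / 3)) ∧
      F '' fccStacking 1 (Real.sqrt (2 / 3)) ≠ (twinFrame L₁ (L₁ (EuclideanSpace.single (2 : Fin 3) (1 : ℝ)))) '' fccStacking 1 (Real.sqrt (2 / 3)))
    (hA3 : ∀ F₁ ∈ chainFrames (EuclideanSpace.single (2 : Fin 3) (1 : ℝ)) (upFrame L₁ (EuclideanSpace.single (2 : Fin 3) (1 : ℝ))) (famSlot L₁ (EuclideanSpace.single (2 : Fin 3) (1 : ℝ))),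
      ∀ F₂ ∈ chainFrames (-EuclideanSpace.single (2 : Fin 3) (1 : ℝ)) (upFrame L₂ (-EuclideanSpace.single (2 : Fin 3) (1 : ℝ))) (famSlot L₂ (-EuclideanSpace.single (2 : Fin 3) (1 : ℝ))),
      ¬ ∃ (L : EuclideanSpace ℝ (Fin 3) ≃ₗᵢ[ℝ] EuclideanSpace ℝ (Fin 3)) (t₁ t₂ : EuclideanSpace ℝ (Fin 3)) (σ σ' : ℤ → ℤ),
        IsHaggSeq σ ∧ IsHaggSeq σ' ∧
        F₁ '' fccStacking 1 (Real.sqrt (2 / 3)) ⊆ (fun p => L p + t₁) '' barlowStacking 1 (Real.sqrt (2 / 3)) σ ∧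
        F₂ '' fccStacking 1 (Real.sqrt (2 / 3)) ⊆ (fun p => L p + t₂) '' barlowStacking 1 (Real.sqrt (2 / 3)) σ')
    (hΔ₁ : DeltaSteep L₁ (EuclideanSpace.single (2 : Fin 3) (1 : ℝ)))
    (hΔ₂ : DeltaSteep L₂ (-EuclideanSpace.single (2 : Fin 3) (1 : ℝ))) :
    ∃ step₁ step₂ : ℤ → EuclideanSpace ℝ (Fin 3),
      IsZigSelector L₁ σ₁ (EuclideanSpace.single (2 : Fin 3) (1 : ℝ)) step₁ ∧
      IsZigSelector L₂ σ₂ (-EuclideanSpace.single (2 : Fin 3) (1 : ℝ)) step₂ ∧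
      ∀ h : ℝ, 0 ≤ h → ∀ ρ : ℝ, R₀ ≤ ρ → ∀ X P₁ P₂ : Finset (EuclideanSpace ℝ (Fin 3)),
      (∀ p ∈ X, ∀ q ∈ X, p ≠ q → 1 ≤ dist p q) → P₁ ⊆ X → P₂ ⊆ X \ P₁ → (∀ p ∈ X, p ∈ cyl R₀ h ρ) →
      (∀ p, p ∈ P₁ ↔ (p ∈ stacking L₁ s₁ σ₁ ∧ -(2 * R₀) ≤ p 2 ∧ p 2 ≤ -R₀ ∧ p 0 ^ 2 + p 1 ^ 2 ≤ ρ ^ 2)) →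
      (∀ p, p ∈ P₂ ↔ (p ∈ stacking L₂ s₂ σ₂ ∧ h + R₀ ≤ p 2 ∧ p 2 ≤ h + 2 * R₀ ∧ p 0 ^ 2 + p 1 ^ 2 ≤ ρ ^ 2)) →
      ∃ (m : ℝ) (T₁ T₂ : Finset (Fin 2 → ℤ)), 0 ≤ m ∧
        (∀ t : Fin 2 → ℤ, (∃ k : ℤ,
          -R₀ - 4 ≤ (L₁ (zigVertexS step₁ k + ((t 0 : ℝ) • triangularVec₁ 1 + (t 1 : ℝ) • triangularVec₂ 1)) + s₁) 2 ∧
          (L₁ (zigVertexS step₁ k + ((t 0 : ℝ) • triangularVec₁ 1 + (t 1 : ℝ) • triangularVec₂ 1)) + s₁) 2 ≤ -R₀ - 3 ∧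
          Real.sqrt ((L₁ (zigVertexS step₁ k + ((t 0 : ℝ) • triangularVec₁ 1 + (t 1 : ℝ) • triangularVec₂ 1)) + s₁) 0 ^ 2 +
            (L₁ (zigVertexS step₁ k + ((t 0 : ℝ) • triangularVec₁ 1 + (t 1 : ℝ) • triangularVec₂ 1)) + s₁) 1 ^ 2) ≤ ρ - m) →
          t ∈ T₁) ∧
        (∀ t : Fin 2 → ℤ, (∃ k : ℤ,
          h + R₀ + 3 ≤ (L₂ (zigVertexS step₂ k + ((t 0 : ℝ) • triangularVec₁ 1 + (t 1 : ℝ) • triangularVec₂ 1)) + s₂) 2 ∧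
          (L₂ (zigVertexS step₂ k + ((t 0 : ℝ) • triangularVec₁ 1 + (t 1 : ℝ) • triangularVec₂ 1)) + s₂) 2 ≤ h + R₀ + 4 ∧
          Real.sqrt ((L₂ (zigVertexS step₂ k + ((t 0 : ℝ) • triangularVec₁ 1 + (t 1 : ℝ) • triangularVec₂ 1)) + s₂) 0 ^ 2 +
            (L₂ (zigVertexS step₂ k + ((t 0 : ℝ) • triangularVec₁ 1 + (t 1 : ℝ) • triangularVec₂ 1)) + s₂) 1 ^ 2) ≤ ρ - m) →
          t ∈ T₂) ∧
        (T₁.card : ℝ) + T₂.card + 18 * m * ρ ≤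
          (∑ y ∈ X.filter (fun y => (X.filter fun q => dist y q = 1).card ≠ 12 ∧ -R₀ - 2 ≤ y 2 ∧ y 2 ≤ h + R₀ + 2),
            ((12 : ℝ) - ((X.filter fun q => dist y q = 1).card : ℝ))) + (318 + 192 * R₀) * (1 + h) * ρ := by
  set e₃ : EuclideanSpace ℝ (Fin 3) := EuclideanSpace.single (2 : Fin 3) (1 : ℝ) with he₃
  -- the two up-presentations
  obtain ⟨hσ₁', hax₁, hst₁, htr₁⟩ := exists_upPresentation L₁ hσ₁ s₁ e₃
  obtain ⟨hσ₂', hax₂, hst₂, htr₂⟩ := exists_upPresentation L₂ hσ₂ s₂ (-e₃)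
  set L₁' := upFrame L₁ e₃ with hL₁'
  set L₂' := upFrame L₂ (-e₃) with hL₂'
  set σ₁' := upWord L₁ σ₁ e₃ with hσ₁'def
  set σ₂' := upWord L₂ σ₂ (-e₃) with hσ₂'def
  -- steepness of the family slots
  have hst1 := famSlot_steep_of_deltaSteep L₁ e₃ hΔ₁
  have hst2 := famSlot_steep_of_deltaSteep L₂ (-e₃) hΔ₂
  have hfam₁ : famSlot L₁ e₃ = best3 (fun w => ⟪w, L₁'.symm e₃⟫_ℝ) upSlot₁ upSlot₂ upSlot₃ := rfl
  have hfam₂ : famSlot L₂ (-e₃) = best3 (fun w => ⟪w, L₂'.symm (-e₃)⟫_ℝ) upSlot₁ upSlot₂ upSlot₃ := rfl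
  rw [hfam₁] at hst1
  rw [hfam₂] at hst2
  -- the apart clauses in the presented form
  rw [hfam₁] at hA1 hA3
  rw [hfam₂] at hA2 hA3
  -- the oriented count for the presented pair
  obtain ⟨step₁', step₂', hsel₁', hsel₂', hmain⟩ := barlow_hlines_oriented_apart hsE hcert hDS hCP hσ₁' hσ₂' L₁' L₂' s₁ s₂ hax₁ hax₂
    hst1 hst2 (fun F hF => apart_upFrame L₂ (-e₃) (hA1 F hF)) (fun F hF => apart_upFrame L₁ e₃ (hA2 F hF)) hA3 R₀ hR₀
  -- transport the selectors
  obtain ⟨step₁, hsel₁, hpt₁⟩ := htr₁ step₁' hsel₁'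
  obtain ⟨step₂, hsel₂, hpt₂⟩ := htr₂ step₂' hsel₂'
  refine ⟨step₁, step₂, hsel₁, hsel₂, ?_⟩
  intro h hh ρ hρ X P₁ P₂ hX hP₁X hP₂X hcyl hP₁ hP₂
  have hP₁' : ∀ p, p ∈ P₁ ↔ (p ∈ stacking L₁' s₁ σ₁' ∧ -(2 * R₀) ≤ p 2 ∧ p 2 ≤ -R₀ ∧ p 0 ^ 2 + p 1 ^ 2 ≤ ρ ^ 2) := by
    intro p; rw [hst₁]; exact hP₁ p
  have hP₂' : ∀ p, p ∈ P₂ ↔ (p ∈ stacking L₂' s₂ σ₂' ∧ h + R₀ ≤ p 2 ∧ p 2 ≤ h + 2 * R₀ ∧ p 0 ^ 2 + p 1 ^ 2 ≤ ρ ^ 2) := by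
    intro p; rw [hst₂]; exact hP₂ p
  obtain ⟨m, T₁, T₂, hm0, hT₁, hT₂, hcount⟩ := hmain h hh ρ hρ X P₁ P₂ hX hP₁X hP₂X hcyl hP₁' hP₂'
  refine ⟨m, T₁, T₂, hm0, fun t ⟨k, hk⟩ => hT₁ t ⟨k, ?_⟩, fun t ⟨k, hk⟩ => hT₂ t ⟨k, ?_⟩, hcount⟩
  · rw [← hpt₁ k t]; exact hk
  · rw [← hpt₂ k t]; exact hk

end Summit.Ventures.Crystal3D.Theorems

end
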